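import Mathlib.NumberTheory.NumberField.Cyclotomic.Ideal
import Literature.NumberTheory.NumberFields.PrimitiveRootRamificationProofs
import Literature.NumberTheory.ComplexMultiplication.WeilTorusLevelsExhaustLimit
import HarnessLib

/-!
# Dyadic places of a number field containing `√−1` resp. `ζ₃`: even ramification index resp. even residue degree

`Proofs` file (theorems only, no definition, no named fact).  Classical algebraic number theory: in `ℚ(√−1) = ℚ(ζ₄)` the
prime `2` is totally ramified, `(2) = (1 + i)²` (Washington, *Introduction to Cyclotomic Fields*, Lemma 1.4 / Prop. 2.1 for
`p^k`-th cyclotomic fields; Mathlib `IsCyclotomicExtension.Rat.ramificationIdx_eq_of_prime_pow`), and in `ℚ(ζ₃)` the prime `2` is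
inert with residue degree `2` (the order of `2` modulo `3`; Neukirch, *Algebraic Number Theory*, Ch. I (10.3); the tree's
`CMNumbers.orderOf_dvd_inertiaDeg_of_isPrimitiveRoot` / `CMNumbers.two_mul_dvd_inertiaDeg_of_isPrimitiveRoot`); ramification indices and residue
degrees multiply in towers (Neukirch Ch. II (6.8); the tree's `ThetaData.absRamificationIdx_eq_ramIdx_mul`, Mathlib
`Ideal.inertiaDeg_tower`).  Hence for a number field `F` and a finite place `w` of `F` over `2`:

* (private) `isPrimitiveRoot_four_of_sq_eq_neg_one'`, `isPrimitiveRoot_three_of_sq_add_self_add_one` — elementwise entries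
  (`i² = −1`, `ζ² + ζ + 1 = 0`, characteristic `0`);
* **`two_dvd_ramificationIdx_of_isPrimitiveRoot_four`** — `F ∋` a primitive 4th root of unity `⟹ 2 ∣ e(w | 2)`;
* **`two_dvd_inertiaDeg_of_isPrimitiveRoot_three`** — `F ∋` a primitive 3rd root of unity `⟹ 2 ∣ f(w | 2)`;
* `two_dvd_ramificationIdx_of_sq_eq_neg_one`, `two_le_inertiaDeg_of_sq_add_self_add_one` — the same from the equations.

Consumer: the abc-iut cell, R-J row Y-29b (print-shaped initial Θ-data, [IUTchI] Def. 3.1 (a)(b): `√−1 ∈ F` and the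
`2·3`-torsion of `E_F` rational, so `ζ₃ ∈ F` by the Weil pairing): every `w ∣ 2` is wildly ramified with residue field `≠ 𝔽₂`.

## References
* [Washington1997] L. C. Washington, *Introduction to Cyclotomic Fields*, 2nd ed. (1997), Lemma 1.4, Prop. 2.1.
* [NeukirchANT1999] J. Neukirch, *Algebraic Number Theory* (1999), Ch. I Prop. (10.3), Ch. II Prop. (6.8).
-/

noncomputable section

open scoped NumberField

namespace Literature.NumberTheory.NumberFields

open NumberField IsDedekindDomain Literature.IUT.LogVolume Literature.NumberTheory.ComplexMultiplication

/-! ## Elementwise entries -/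

/-- `i² = −1` in characteristic `0` `⟹` `i` is a primitive 4th root of unity (private helper). [folklore] -/
private theorem isPrimitiveRoot_four_of_sq_eq_neg_one' {F : Type} [Field F] [CharZero F] {i : F} (hi : i ^ 2 = -1) :
    IsPrimitiveRoot i 4 := by
  refine (IsPrimitiveRoot.iff (by norm_num)).mpr ⟨by rw [show (4 : ℕ) = 2 * 2 from rfl, pow_mul, hi]; norm_num, ?_⟩
  intro l hl0 hl4
  interval_cases l
  · -- `i ≠ 1`
    rw [pow_one]
    intro h
    rw [h, one_pow] at hi
    norm_num at hi
  · rw [hi]; norm_num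
  · rw [pow_succ, hi]
    intro h
    have h2 : i ^ 2 = 1 := by
      have : i = -1 := by linear_combination (-1 : F) * h
      rw [this]; norm_num
    rw [hi] at h2
    norm_num at h2

/-- `ζ² + ζ + 1 = 0` in characteristic `0` `⟹` `ζ` is a primitive 3rd root of unity (private helper). [folklore] -/
private theorem isPrimitiveRoot_three_of_sq_add_self_add_one {F : Type} [Field F] [CharZero F] {ζ : F} (hζ : ζ ^ 2 + ζ + 1 = 0) :
    IsPrimitiveRoot ζ 3 := by
  refine (IsPrimitiveRoot.iff (by norm_num)).mpr ⟨by linear_combination (ζ - 1) * hζ, ?_⟩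
  intro l hl0 hl3
  interval_cases l
  · rw [pow_one]
    intro h
    rw [h] at hζ
    norm_num at hζ
  · intro h
    have h3 : ζ = -2 := by linear_combination hζ - h
    rw [h3] at hζ
    norm_num at hζ

/-! ## `√−1 ∈ F ⟹ 2 ∣ e(w | 2)` -/

/-- **`ζ₄ ∈ F` ⟹ `2 ∣ e(w | 2)`** for every finite place `w` of the number field `F` over `2`: the subfield `ℚ(ζ₄) ⊆ F` is the
`2²`-th cyclotomic field, in which `2` is totally ramified of index `2¹·(2 − 1) = 2`
(Mathlib `IsCyclotomicExtension.Rat.ramificationIdx_eq_of_prime_pow`), and ramification indices multiply in the tower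
`ℤ ⊆ 𝓞_{ℚ(ζ₄)} ⊆ 𝓞_F` (the tree's `ThetaData.absRamificationIdx_eq_ramIdx_mul`).
[cite: Washington1997, Lemma 1.4 and Prop. 2.1] [cite: NeukirchANT1999, Ch. II Prop. (6.8)] -/
theorem two_dvd_ramificationIdx_of_isPrimitiveRoot_four {F : Type} [Field F] [NumberField F] {i : F}
    (hi : IsPrimitiveRoot i 4) (w : HeightOneSpectrum (𝓞 F)) (hw : ((2 : ℕ) : 𝓞 F) ∈ w.asIdeal) :
    2 ∣ w.asIdeal.ramificationIdx ℤ := by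
  haveI : Fact (Nat.Prime 2) := ⟨Nat.prime_two⟩
  -- the cyclotomic subfield `K₀ = ℚ(ζ₄) ⊆ F`
  set K₀ : IntermediateField ℚ F := IntermediateField.adjoin ℚ {i} with hK₀
  haveI h4 : IsCyclotomicExtension {4} ℚ K₀ := hi.intermediateField_adjoin_isCyclotomicExtension ℚ
  haveI : IsCyclotomicExtension {2 ^ (1 + 1)} ℚ K₀ := by simpa using h4
  -- the place of `K₀` under `w` lies over `2`
  set v₀ : HeightOneSpectrum (𝓞 K₀) := w.under (𝓞 K₀) with hv₀
  have hpv₀ : ((2 : ℕ) : 𝓞 K₀) ∈ v₀.asIdeal := by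
    change ((2 : ℕ) : 𝓞 K₀) ∈ w.asIdeal.comap (algebraMap (𝓞 K₀) (𝓞 F))
    rw [Ideal.mem_comap, map_natCast]
    exact hw
  haveI := v₀.isPrime
  haveI : v₀.asIdeal.LiesOver (Ideal.span {((2 : ℕ) : ℤ)}) := by
    refine ⟨?_⟩
    have hpr : Prime ((2 : ℕ) : ℤ) := Nat.prime_iff_prime_int.mp Nat.prime_two
    have hmax : (Ideal.span {((2 : ℕ) : ℤ)}).IsMaximal :=
      ((Ideal.span_singleton_prime hpr.ne_zero).mpr hpr).isMaximal (by
        rw [Ne, Ideal.span_singleton_eq_bot]; exact hpr.ne_zero)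
    have hle : Ideal.span {((2 : ℕ) : ℤ)} ≤ v₀.asIdeal.under ℤ := by
      rw [Ideal.span_le, Set.singleton_subset_iff, SetLike.mem_coe, Ideal.mem_comap, map_natCast]
      exact hpv₀
    have hne : v₀.asIdeal.under ℤ ≠ ⊤ := Ideal.IsPrime.ne_top inferInstance
    exact hmax.eq_of_le hne hle
  have hram : ramIdx K₀ v₀ = 2 := by
    rw [ramIdx_eq]
    have h := IsCyclotomicExtension.Rat.ramificationIdx_eq_of_prime_pow 2 1 (K := K₀) v₀.asIdeal
    simpa using h
  rw [ThetaData.absRamificationIdx_eq_ramIdx_mul (F := K₀) w, ← hv₀, hram]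
  exact dvd_mul_right _ _

/-- **`i² = −1` in `F` ⟹ `2 ∣ e(w | 2)`** at every finite place `w ∣ 2`. [cite: Washington1997, Lemma 1.4 and Prop. 2.1]
[cite: NeukirchANT1999, Ch. II Prop. (6.8)] -/
theorem two_dvd_ramificationIdx_of_sq_eq_neg_one {F : Type} [Field F] [NumberField F] {i : F} (hi : i ^ 2 = -1)
    (w : HeightOneSpectrum (𝓞 F)) (hw : ((2 : ℕ) : 𝓞 F) ∈ w.asIdeal) : 2 ∣ w.asIdeal.ramificationIdx ℤ :=
  two_dvd_ramificationIdx_of_isPrimitiveRoot_four (isPrimitiveRoot_four_of_sq_eq_neg_one' hi) w hw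

/-! ## `ζ₃ ∈ F ⟹ 2 ∣ f(w | 2)` -/

/-- **`ζ₃ ∈ F` ⟹ `2 ∣ f(w | 2)`** for every finite place `w` of the number field `F` over `2`: the order of `2` modulo `3 = 2² − 1`
is `2`, and it divides the residue degree of every prime over `2` of a number field containing `ζ₃` (the tree's
`CMNumbers.two_mul_dvd_inertiaDeg_of_isPrimitiveRoot` at `p = 2`, `d = 1`). [cite: NeukirchANT1999, Ch. I Prop. (10.3), Ch. II Prop. (6.8)] -/
theorem two_dvd_inertiaDeg_of_isPrimitiveRoot_three {F : Type} [Field F] [NumberField F] {ζ : F}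
    (hζ : IsPrimitiveRoot ζ 3) (w : HeightOneSpectrum (𝓞 F)) (hw : ((2 : ℕ) : 𝓞 F) ∈ w.asIdeal) :
    2 ∣ w.asIdeal.inertiaDeg ℤ := by
  haveI : Fact (Nat.Prime 2) := ⟨Nat.prime_two⟩
  haveI := w.isPrime
  haveI : w.asIdeal.LiesOver (Ideal.span {((2 : ℕ) : ℤ)}) := by
    refine ⟨?_⟩
    have hpr : Prime ((2 : ℕ) : ℤ) := Nat.prime_iff_prime_int.mp Nat.prime_two
    have hmax : (Ideal.span {((2 : ℕ) : ℤ)}).IsMaximal :=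
      ((Ideal.span_singleton_prime hpr.ne_zero).mpr hpr).isMaximal (by
        rw [Ne, Ideal.span_singleton_eq_bot]; exact hpr.ne_zero)
    have hle : Ideal.span {((2 : ℕ) : ℤ)} ≤ w.asIdeal.under ℤ := by
      rw [Ideal.span_le, Set.singleton_subset_iff, SetLike.mem_coe, Ideal.mem_comap, map_natCast]
      exact hw
    have hne : w.asIdeal.under ℤ ≠ ⊤ := Ideal.IsPrime.ne_top inferInstance
    exact hmax.eq_of_le hne hle
  have hζ' : IsPrimitiveRoot ζ (2 ^ (2 * 1) - 1) := by simpa using hζ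
  have h := CMNumbers.two_mul_dvd_inertiaDeg_of_isPrimitiveRoot 2 (d := 1) one_ne_zero hζ' w.asIdeal
  simpa using h

/-- **`ζ² + ζ + 1 = 0` in `F` ⟹ `2 ≤ f(w | 2)`** at every finite place `w ∣ 2` (`2 ∣ f` and `f ≥ 1`).
[cite: NeukirchANT1999, Ch. I Prop. (10.3), Ch. II Prop. (6.8)] -/
theorem two_le_inertiaDeg_of_sq_add_self_add_one {F : Type} [Field F] [NumberField F] {ζ : F} (hζ : ζ ^ 2 + ζ + 1 = 0)
    (w : HeightOneSpectrum (𝓞 F)) (hw : ((2 : ℕ) : 𝓞 F) ∈ w.asIdeal) : 2 ≤ w.asIdeal.inertiaDeg ℤ := by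
  haveI := w.isPrime
  exact Nat.le_of_dvd (Ideal.inertiaDeg_pos _ _)
    (two_dvd_inertiaDeg_of_isPrimitiveRoot_three (isPrimitiveRoot_three_of_sq_add_self_add_one hζ) w hw)

end Literature.NumberTheory.NumberFields

end
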